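import Summits.FinalStateConjecture.FinalStateConjecture.Theorems.NearExtremalKappaCapture.Negative.ExponentMonotonicity
import Summits.FinalStateConjecture.FinalStateConjecture.Theorems.NearExtremalKappaCapture.Negative.SubextremalRedundancy
import Summits.FinalStateConjecture.FinalStateConjecture.Theorems.PhaseMixingCaptureNearExtremalKappaCaptureBudgetModulus
import Summits.FinalStateConjecture.FinalStateConjecture.Theorems.PhaseMixingCaptureNearExtremalKappaCaptureFarCompleteTransport
import Summits.FinalStateConjecture.FinalStateConjecture.Theorems.PhaseMixingCaptureNearExtremalKappaCaptureLawBookkeeping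
import Literature.Geometry.Lorentzian.KerrSurfaceGravity
import Literature.Geometry.Lorentzian.EventHorizonAreaLaw
import Literature.Geometry.Lorentzian.RadiatedEnergy
import Literature.Geometry.Lorentzian.AchronalBoundaryProofs
import Literature.Geometry.Lorentzian.KerrDataADMEnergy
import Literature.Geometry.Lorentzian.KerrDataAsymptoticFlatness
import Literature.Geometry.Lorentzian.ADMEnergyPinning

/-!
# Line `area-excess-ratchet` — skeleton REV 2.3 for crux `NearExtremalKappaCapture`
# (stmt-FinalStateConjecture-10606, route PhaseMixingCapture; lead prover-line-stmt-FinalStateConjecture-10606-c1-0)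

Rev 1 = the crux-plan skeleton (planner-cruxplan-…-area-excess-ratchet-0, 2026-08-16; 4 stubs E/F/α/β).
REV 2 (this file, 2026-08-16, after wave 1): the INTERFACE AUDIT of wave 1 found the three law stubs
F/α/β MIS-STATED for one common structural reason — the hand-over `Spacetime.ConvergesToKerr 𝒟oc M′ a′ k`
with the region `𝒟oc` FREE is a bare late-chart statement (`𝒟oc := Ψ '' lateRegion τ₀` discharges
`IsLateEmbedding.diff_subset_causalPast`; `exists_convergesToKerr_iff_lateChart`): it hands over no event
horizon, no `𝓘⁺`, no link to `i⁰`. So "captured ⇒ far-complete" as typed was the `𝓘⁺`-half of the open crux,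
"no mass gain" needed chart rigidity + a Bondi structure nothing in the tree constructs (+ Hintz
arXiv:2606.28253 Conj. 13.8 in this range), and "area ratchet" needed a horizon package. The separable
classical content of each law was PROVED by the workers in the tree's own vocabulary, and the packages the
laws consume are now handed over by the ENGINE — which is what every stability theorem's bootstrap delivers
anyway (KS 2023 Def. 3.4.5 `𝓜_∞` future-null-complete; conclusions at `𝓘⁺`; horizon location):

* S1 `stub_closedFamilyCapturePackage` (ENGINE E⁺, OPEN, lead) — basin `c χ^γ` ⇒ late region `C⁰`-converging
  (rev 2.1: `k = 0`, all the `∃ k`-crux needs) to SOME closed-family Kerr `(M′, a′)` + `J`-budget (rev 1's E)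
  AND the three hand-over packages: (P_F) SOME vacuum Cauchy development of the datum is far-complete; (P_α) a
  canonical future Bondi foliation of the MGHD for the end `Kerr.afEnd a M` with `M′ ≤ M_B(+∞) + Cχ^{-q}√dist`;
  (P_β) an advanced-time area foliation `A` of the intrinsic event horizon `∂(visible region)` with
  future-complete generators, one section out-area-ing the collar budget `8π(M r₊ − C M² χ^{-q} √dist)`, and
  section areas frequently below `8π M′ r₊(M′,a′) + ε`. NOT asked of E⁺: any LOWER bound on `M′` (no
  evaporation control), monotonicity of areas (the second law), sub-extremality / temperature of the limit, `E_ADM`.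
* S2 `stub_farCompleteTransport` (F′) — LANDED p102813 (`Theorems/…FarCompleteTransport.lean`): the MGHD inherits
  complete `𝓘⁺` from ANY far-complete vacuum Cauchy development of the data (CBG transport).
* S3 `stub_admPinning` (α₂, classical, Bartnik CPAM 39 (1986) §4) — LANDED p105380 (`Theorems/…ADMPinning.lean`) over
  `Literature/…/ADMEnergyPinning.lean` (p103697): linearised Bartnik, weighted `L² → L¹`, Gauss–Green flux lemma, `N₀ = 2`.
* law α′ `massBoundBondi` — PROVED inline (Bondi bookkeeping `M′ ≤ M_B(+∞) + B`, `M_B(+∞) ≤ E_ADM = M` ⇒ `M′ ≤ M + B`;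
  also landed in `Theorems/…LawBookkeeping.lean`, p102805).
* S5 `stub_areaRatchetLaw` (β′) — LANDED p102805 (`Theorems/…LawBookkeeping.lean`): the RATCHET — the CDGH area theorem
  (named fact `ChruscielEtAl2001_areaTheorem`) with Hawking–Ellis 6.3.1 (tree THEOREM
  `HawkingEllis1973_achronalBoundary_holds`) makes `A.horizonArea` monotone; collar section ≤ later sections ≤
  `8πM′r₊′ + ε` ⇒ `M r₊ − C M² χ^{-q} √dist ≤ M′ r₊′`.
* fact-stubs: `stub_areaTheoremFact` (= `ChruscielEtAl2001_areaTheorem`, OPEN named fact, XL) and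
  `stub_kerrADMEnergyFact` (= `Kerr.hasADMEnergy_data` on the sub-extremal range — DISCHARGED by wave-2 worker for
  all `M, a, r₀`: `Kerr.hasADMEnergy_data_holds`, `Literature/…/KerrDataADMEnergy.lean`, p103492; proved here from it).
* S6 `modulus_of_budgets` — LANDED p96621 (`Theorems/…BudgetModulus.lean`): first-law steepness, the budgets pin `(M′, a′)`.
Exact-Kerr collar certificate (metric/area half) PROVED by wave-1 worker (`Δ(r₊ − θM√χ) = −θ(2−θ)M²χ`, induced
2-metric of `{t* = 0, r = r₀}` in BL form, section area `≥ 4π(r₀² + a²)` where `Δ ≤ 0`, `= 8πMr₊` at `r₊`) —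
re-homed to `Literature/…/KerrCoordinateEllipsoid.lean` + `KerrTrappedCollarRadius.lean` (review); it prices (P_β)'s
collar clause at `χ^{-1/2}·dist`.

COMPOSITION (kernel-checked, unconditional): `captureWith_of_stubs` at exponents `s = δ = γ = N`,
`N = N_E + N_A + 2q + 2`, `k = 0`, `p = q`, and `NearExtremalKappaCapture_of` BY NAME via `Negative.near_iff`.
REV 2.3: the line is CLOSED MODULO {S1 (open problem), `ChruscielEtAl2001_areaTheorem` (named fact)} — 2 sorries.

Disproof.lean v4.2 (cdisprove cycle 3; no `_false_without_` theorem; "no kill") honoured as in rev 1: §2 diagonal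
exponents; §3 at `dist = 0` all budgets vanish and E⁺'s packages are those of Kerr itself; §4/§9 third-law fork
defeated by the mechanism (ratchet + Bondi) for `γ ≥ 2q + 2`, sub-extremality re-derived
(`Negative.isSubextremal_of_drift`); §6/§10 `γ = δ = N ≥ 2`, `p = q ≥ 0` inside every necessary region; §11 targets
were the other line's. Wave-1 evidence: reports attached to the crux item (reshape-note-rev2.md, hand-over-audit.md).
-/

noncomputable section

set_option linter.dupNamespace false

namespace Summit.FinalStateConjecture.FinalStateConjecture.Cruxes.NearExtremalKappaCapture.AreaExcessRatchet

open Literature.Geometry.Lorentzian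
open Summit.FinalStateConjecture.FinalStateConjecture.Theorems.NearExtremalKappaCapture.Negative
open Summit.FinalStateConjecture.FinalStateConjecture.Theorems.NearExtremalKappaCapture.AreaExcessRatchet
open scoped Manifold ContDiff Topology ENNReal
open Set Filter

/-! ## Registered stubs (the only `sorry`s of the line) -/

/-- **S1 — `stub_closedFamilyCapturePackage` (ENGINE E⁺; hardest, load-bearing, OPEN).** κ-polynomial
orbital capture of near-extremal Kerr by the CLOSED Kerr family with `J`-bookkeeping, handing over the
final-state PACKAGES the conservation laws consume: there are `a₁ < 1` and thresholds `N₀, q` with: for all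
`s, δ, γ ≥ N₀`, every `M > 0`, some `c > 0`, `C`, every vacuum
datum `D` on `Kerr.slice a M` (`a₁M ≤ |a| < M`) with `dist_{H^s_δ}(D, Kerr(M,a)) < c (1 − a²/M²)^γ` has all
its maximal vacuum Cauchy developments `𝒟` containing a late region `C⁰`-converging (Kerr–Schild pullback
gauge; `k = 0` is all the `∃ k`-crux needs, `Negative.near_iff_diagonal` — rev 2.1 drops rev 2's `∀ k`) to
SOME `g_{M′,a′}`, `0 < M′`, `|a′| ≤ M′` (extremal limits allowed), with
`|a′M′ − aM| ≤ C χ^{-q} √dist`, and moreover: (P_F) some vacuum Cauchy development of `D` is far-complete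
(sojourn form `FarComplete`); (P_α) `𝒟` carries a canonical future Bondi foliation for the end
`Kerr.afEnd a M` whose final Bondi mass dominates `M′` up to `C χ^{-q} √dist`; (P_β) the intrinsic future
event horizon of `𝒟` has future-complete generators and an advanced-time area foliation `A` with one section
of area `≥ 8π(M r₊(M,a) − C M² χ^{-q} √dist)` (the swallowed trapped collar) and sections frequently of area
`≤ 8π M′ r₊(M′,a′) + ε` for every `ε > 0` (final area). NOT asked: a lower bound on `M′`, monotone areas,
sub-extremality of the limit, `E_ADM`. Why plausibly true: every printed stability theorem delivers exactly
these by-products (Klainerman–Szeftel 2023 Main Thm + Def. 3.4.5; Hintz arXiv:2606.28253 Thm 1.1 at fixed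
`|a| < M`, qualitative constants); the κ-polynomial rate is the route's bet. Size: open-problem. -/
theorem stub_closedFamilyCapturePackage [Kerr.Facts] [Kerr.SliceFacts] :
    ∃ a₁ : ℝ, a₁ < 1 ∧ ∃ N₀ q : ℕ, ∀ (s : ℕ) (δ γ : ℝ),
      N₀ ≤ s → (N₀ : ℝ) ≤ δ → (N₀ : ℝ) ≤ γ →
      ∀ (M : ℝ) (hM : 0 < M), ∃ c > (0 : ℝ), ∃ C : ℝ, ∀ a : ℝ, a₁ * M ≤ |a| →
        Kerr.IsSubextremal M a →
          ∀ (D : InitialDataSet 𝓘(ℝ, E3) (Kerr.slice a M)) [D.metric.HasLeviCivita],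
            D.IsVacuumConstraintSolution →
              InitialDataSet.dataWeightedSobolevEDist s δ D (Kerr.data M a M hM.le) <
                  ENNReal.ofReal (c * (1 - (a / M) ^ 2) ^ γ) →
                ∀ 𝒟 : VacuumCauchyDevelopment D, 𝒟.IsMaximal →
                  ∃ (M' a' : ℝ) (𝒟oc : Set 𝒟.carrier), 0 < M' ∧ |a'| ≤ M' ∧
                    𝒟.toSpacetime.ConvergesToKerr 𝒟oc M' a' 0 ∧
                    |a' * M' - a * M| ≤ C * (1 - (a / M) ^ 2) ^ (-(q : ℝ)) *
                      √(InitialDataSet.dataWeightedSobolevEDist s δ D (Kerr.data M a M hM.le)).toReal ∧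
                    (∃ 𝒟' : VacuumCauchyDevelopment D, FarComplete 𝒟') ∧
                    (∃ 𝓕 : 𝒟.toCauchyDevelopment.FutureBondiFoliation,
                      𝓕.IsCanonical (Kerr.afEnd a M) D ∧
                        M' ≤ 𝓕.finalBondiMass + C * (1 - (a / M) ^ 2) ^ (-(q : ℝ)) *
                          √(InitialDataSet.dataWeightedSobolevEDist s δ D (Kerr.data M a M hM.le)).toReal) ∧
                    (∀ [𝒟.metric.HasLeviCivita],
                      ∃ A : EventHorizonArea 𝒟.toCauchyDevelopment 𝒟.completeNullRayRegion,
                        𝒟.toSpacetime.IsRuledByCompleteNullGeodesics 𝒟.futureEventHorizon ∧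
                        (∃ v₀, ENNReal.ofReal (8 * Real.pi * (M * Kerr.rPlus M a -
                            C * M ^ 2 * (1 - (a / M) ^ 2) ^ (-(q : ℝ)) *
                              √(InitialDataSet.dataWeightedSobolevEDist s δ D
                                (Kerr.data M a M hM.le)).toReal)) ≤ A.horizonArea v₀) ∧
                        ∀ ε : ℝ, 0 < ε → ∃ᶠ v in atTop,
                          A.horizonArea v ≤
                            ENNReal.ofReal (8 * Real.pi * (M' * Kerr.rPlus M' a') + ε)) := by
  sorry

/-- **S2 — `stub_farCompleteTransport` (law F′: the MGHD inherits complete `𝓘⁺`; LANDED p102813,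
`Theorems/PhaseMixingCaptureNearExtremalKappaCaptureFarCompleteTransport.lean`).** A maximal vacuum Cauchy development of data on the
Kerr–Schild slice is far-complete (sojourn form) as soon as ANY vacuum Cauchy development of the same data
is: restricted-origin sojourn completeness is inherited along the embedding `𝒟' ↪ 𝒟` given by maximality
(Choquet-Bruhat–Geroch transport; exactly how Klainerman–Szeftel pass from their bootstrap spacetime `𝓜_∞`,
Def. 3.4.4–3.4.5, to the MGHD). Size S given the worker's 200-line transport lemma. -/
theorem stub_farCompleteTransport [Kerr.SliceFacts] {a M : ℝ}
    {D : InitialDataSet 𝓘(ℝ, E3) (Kerr.slice a M)} {𝒟 : VacuumCauchyDevelopment D}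
    (h𝒟 : 𝒟.IsMaximal) (𝒟' : VacuumCauchyDevelopment D) (h' : FarComplete 𝒟') :
    FarComplete 𝒟 :=
  Summit.FinalStateConjecture.FinalStateConjecture.Theorems.NearExtremalKappaCapture.AreaExcessRatchet.stub_farCompleteTransport h𝒟 𝒟' h'

/-- **S3 — `stub_admPinning` (law α₂: the basin pins the ADM energy; classical — LANDED p105380,
`Theorems/…ADMPinning.lean`, over the reusable `Literature/Geometry/Lorentzian/ADMEnergyPinning.lean`, p103697:
linearised Bartnik, weighted `L² → L¹` + Gauss–Green flux lemma, `N₀ = 2`).** There is a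
threshold `N₀` such that for `s ≥ N₀`, `δ ≥ N₀`, every `M > 0` and sub-extremal `a`: granted the named fact
`Kerr.hasADMEnergy_data M a M` (`E_ADM` of the Kerr–Schild slice datum is `M`), every vacuum-constraint
solution `D` on `Kerr.slice a M` at FINITE `H^s_δ`-distance from `Kerr.data M a M` has ADM energy `M` on the
end `Kerr.afEnd a M` (`AFEnd.HasADMEnergy`: the flux integrals converge to `M`). Why true: the tree's weight
is `(1 + r)^{2(δ+m)}` on `D^m`, so for `δ ≥ −1/2` a finite distance excludes any `1/r` discrepancy and the flux
difference over `S_r` is `o(1)` (Bartnik, CPAM 39 (1986), §4, Prop. 4.1 / Thm. 4.2; triage r1-2 R2). Why it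
might fail: only through the tree's definitions (existence of the flux LIMIT for `D` uses integrable scalar
curvature, cf. the named fact `HasADMEnergy_of_isAsymptoticallyFlat`) — then restate with that fact as a
hypothesis. Size L. -/
theorem stub_admPinning [Kerr.Facts] [Kerr.SliceFacts] :
    ∃ N₀ : ℕ, ∀ (s : ℕ) (δ : ℝ), N₀ ≤ s → (N₀ : ℝ) ≤ δ →
      ∀ (M : ℝ) (hM : 0 < M) (a : ℝ), Kerr.IsSubextremal M a → Kerr.hasADMEnergy_data M a M →
        ∀ (D : InitialDataSet 𝓘(ℝ, E3) (Kerr.slice a M)) [D.metric.HasLeviCivita],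
          D.IsVacuumConstraintSolution →
            InitialDataSet.dataWeightedSobolevEDist s δ D (Kerr.data M a M hM.le) < ⊤ →
              (Kerr.afEnd a M).HasADMEnergy D M := by
  -- verbatim the landed proof (p105380), from the Literature pinning theorem (p103697); kept inline so that
  -- this workfile elaborates before the farm snapshot has built `Theorems/…ADMPinning.lean`
  refine ⟨2, fun s δ hs hδ M hM a _ hK D _ _ hdist ↦ ?_⟩
  have hδ1 : (1 : ℝ) ≤ δ := by
    have h2 : ((2 : ℕ) : ℝ) ≤ δ := hδ
    push_cast at h2
    linarith
  have hchart : ∀ (D' : InitialDataSet 𝓘(ℝ, E3) (Kerr.slice a M)) (z : E3), Kerr.afRadius a M < ‖z‖ →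
      AFEnd.hCoeff (Kerr.afEnd a M) D' z = D'.hFun z := by
    intro D' z hz
    have hz' : (Kerr.afEnd a M).R < ‖z‖ := hz
    ext v w
    have h := AFEnd.hCoeff_apply_eq_dataChart (Kerr.afEnd a M) D' ⟨z, hz'⟩ v w
    rw [Kerr.mfderiv_dataChart_afEnd_apply, Kerr.mfderiv_dataChart_afEnd_apply] at h
    rw [InitialDataSet.hFun_of_mem D' (Kerr.mem_slice_of_lt_norm hz)]
    exact h
  exact (Kerr.afEnd a M).hasADMEnergy_of_dataWeightedSobolevEDist_lt_top
    (fun D' z hz ↦ hchart D' z hz) (fun z hz ↦ Kerr.mem_slice_of_lt_norm hz)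
    D (Kerr.data M a M hM.le) hs hδ1 hdist (hK hM.le)

/-- **Law α′ — `massBoundBondi` (no mass gain, Bondi form; PROVED — wave-1 worker's
`stub_massBound_bondiForm`, kernel-checked here, 4 lines).** If the datum has ADM energy `M` on
`Kerr.afEnd a M`, the development carries a canonical future Bondi foliation `𝓕` for that end, and
`M′ ≤ M_B(+∞) + B` with the line's budget `B = C χ^{-q} √dist`, then `M′ ≤ M + B` (`M_B(+∞) ≤ M_B(u) ≤ E_ADM`:
Bondi–van der Burg–Metzner 1962 §5, Christodoulou–Klainerman 1993 Ch. 17, Ashtekar–Magnon-Ashtekar 1979 — in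
the tree the fields of `IsCanonical`, `LorentzianMetric.BondiFoliation.finalBondiMass_le_admEnergy`). -/
theorem massBoundBondi [Kerr.Facts] [Kerr.SliceFacts] {s q : ℕ} {δ C a M M' : ℝ}
    (hM : 0 < M) {D : InitialDataSet 𝓘(ℝ, E3) (Kerr.slice a M)}
    (hE : (Kerr.afEnd a M).HasADMEnergy D M) {𝒟 : VacuumCauchyDevelopment D}
    {𝓕 : 𝒟.toCauchyDevelopment.FutureBondiFoliation} (h𝓕 : 𝓕.IsCanonical (Kerr.afEnd a M) D)
    (hM' : M' ≤ 𝓕.finalBondiMass + C * (1 - (a / M) ^ 2) ^ (-(q : ℝ)) *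
      √(InitialDataSet.dataWeightedSobolevEDist s δ D (Kerr.data M a M hM.le)).toReal) :
    M' ≤ M + C * (1 - (a / M) ^ 2) ^ (-(q : ℝ)) *
      √(InitialDataSet.dataWeightedSobolevEDist s δ D (Kerr.data M a M hM.le)).toReal := by
  have h₁ : 𝓕.finalBondiMass ≤ AFEnd.admEnergy (Kerr.afEnd a M) D :=
    LorentzianMetric.BondiFoliation.finalBondiMass_le_admEnergy h𝓕
  rw [hE.admEnergy_eq] at h₁
  linarith

/-- **S5 — `stub_areaRatchetLaw` (law β′: THE RATCHET against the named area theorem; LANDED p102805,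
`Theorems/PhaseMixingCaptureNearExtremalKappaCaptureLawBookkeeping.lean`, with law α′ and the interface lemma).** For the intrinsic event horizon
`𝓗⁺ = ∂(visible region)` of a vacuum Cauchy development (`U = 𝒟.completeNullRayRegion`) with
future-complete generators and an advanced-time area foliation `A`: the CDGH area theorem (named fact
`ChruscielEtAl2001_areaTheorem`, AHP 2 (2001) Thm 1.1(b)) with Hawking–Ellis Prop. 6.3.1 (named fact
`HawkingEllis1973_achronalBoundary`) makes `A.horizonArea` monotone
(`VacuumCauchyDevelopment.monotone_horizonArea_of_achronalBoundary`); so a section out-area-ing the collar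
budget and sections frequently below `8πM′r₊′ + ε` force `M r₊ − C M² χ^{-q} √dist ≤ M′ r₊(M′,a′)`. Size S. -/
theorem stub_areaRatchetLaw [Kerr.Facts] [Kerr.SliceFacts]
    (hAT : ChruscielEtAl2001_areaTheorem.{0}) (h631 : HawkingEllis1973_achronalBoundary.{0})
    {s q : ℕ} {δ C a M M' a' : ℝ} (hM : 0 < M) {D : InitialDataSet 𝓘(ℝ, E3) (Kerr.slice a M)}
    (𝒟 : VacuumCauchyDevelopment D) [𝒟.metric.HasLeviCivita]
    (A : EventHorizonArea 𝒟.toCauchyDevelopment 𝒟.completeNullRayRegion)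
    (hgen : 𝒟.toSpacetime.IsRuledByCompleteNullGeodesics 𝒟.futureEventHorizon)
    (hcollar : ∃ v₀, ENNReal.ofReal (8 * Real.pi * (M * Kerr.rPlus M a -
        C * M ^ 2 * (1 - (a / M) ^ 2) ^ (-(q : ℝ)) *
          √(InitialDataSet.dataWeightedSobolevEDist s δ D (Kerr.data M a M hM.le)).toReal)) ≤
      A.horizonArea v₀)
    (hfinal : ∀ ε : ℝ, 0 < ε → ∃ᶠ v in atTop,
      A.horizonArea v ≤ ENNReal.ofReal (8 * Real.pi * (M' * Kerr.rPlus M' a') + ε))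
    (hM' : 0 < M') :
    M * Kerr.rPlus M a - C * M ^ 2 * (1 - (a / M) ^ 2) ^ (-(q : ℝ)) *
        √(InitialDataSet.dataWeightedSobolevEDist s δ D (Kerr.data M a M hM.le)).toReal ≤
      M' * Kerr.rPlus M' a' :=
  Summit.FinalStateConjecture.FinalStateConjecture.Theorems.NearExtremalKappaCapture.AreaExcessRatchet.stub_areaRatchetLaw hAT h631 hM 𝒟 A hgen hcollar hfinal hM'

/-- **F — `stub_areaTheoremFact` (FACT-STUB: the second law's input, the NAMED Literature fact
`ChruscielEtAl2001_areaTheorem`, OPEN in the tree).** The Chruściel–Delay–Galloway–Howard area theorem (AHP 2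
(2001) Thm 1.1(b)): areas of sections of a future event horizon with complete generators are non-decreasing under
the null energy condition (automatic in vacuum). A published theorem vendored as a named fact; discharging it
(`…_holds`) is Literature debt (XL: the paper's geometric measure theory), registered here so that the
skeleton's hypotheses are declared. (Rev 2: the companion input Hawking–Ellis Prop. 6.3.1 is NOT a stub any
more — it is the tree THEOREM `HawkingEllis1973_achronalBoundary_holds`, AchronalBoundaryProofs.lean.) -/
theorem stub_areaTheoremFact : ChruscielEtAl2001_areaTheorem.{0} := by
  sorry

/-- **F — `stub_kerrADMEnergyFact` (FACT-STUB: `E_ADM` of the Kerr–Schild slice datum is `M`, the NAMED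
Literature fact `Kerr.hasADMEnergy_data M a M` — DISCHARGED by the wave-2 worker for ALL `M, a, r₀`:
`Kerr.hasADMEnergy_data_holds`, `Literature/Geometry/Lorentzian/KerrDataADMEnergy.lean`, p103492; also landed as the
stub file `Theorems/…KerrADMEnergy.lean`, p104795).** For `0 < M`, `|a| < M`, the ADM energy
flux of `Kerr.data M a M` on the end `Kerr.afEnd a M` converges to `M` (Kerr 1963; ADM 1962; in Kerr–Schild
Cartesian coordinates `h = δ + 2H ℓ⊗ℓ`, `H = Mr³/(r⁴ + a²z²)`, flux `→ M`). Gives ADM pinning (S3) its centre value. -/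
theorem stub_kerrADMEnergyFact [Kerr.Facts] [Kerr.SliceFacts] :
    ∀ (M a : ℝ), 0 < M → Kerr.IsSubextremal M a → Kerr.hasADMEnergy_data M a M :=
  fun M a _ _ ↦ Kerr.hasADMEnergy_data_holds M a M

/-! ## Real arithmetic of the ratchet: LANDED (p96621,
`Theorems/PhaseMixingCaptureNearExtremalKappaCaptureBudgetModulus.lean`: `modulus_of_budgets` = registered S6,
`mass_drop_le_of_budgets`, the four small absorptions) and `Negative.isSubextremal_of_drift` (p74448) — imported. -/

/-! ## The composition (kernel-checked, no `sorry` of its own) -/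

/-- `|C| c ≤ 1/16` once `c ≤ 1/(16(|C|+1))`. -/
theorem abs_mul_le_sixteenth {C c : ℝ} (hc : c ≤ 1 / (16 * (|C| + 1))) : |C| * c ≤ 1 / 16 := by
  calc |C| * c ≤ |C| * (1 / (16 * (|C| + 1))) := mul_le_mul_of_nonneg_left hc (abs_nonneg _)
    _ ≤ 1 / 16 := by
        rw [mul_one_div, div_le_div_iff₀ (by positivity) (by positivity)]
        nlinarith [abs_nonneg C]

/-- `|C| c ≤ M²/16` once `c ≤ M²/(16(|C|+1))`. -/
theorem abs_mul_le_sq_sixteenth {C c M : ℝ} (hc : c ≤ M ^ 2 / (16 * (|C| + 1))) :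
    |C| * c ≤ M ^ 2 / 16 := by
  calc |C| * c ≤ |C| * (M ^ 2 / (16 * (|C| + 1))) := mul_le_mul_of_nonneg_left hc (abs_nonneg _)
    _ ≤ M ^ 2 / 16 := by
        rw [mul_div_assoc', div_le_div_iff₀ (by positivity) (by positivity)]
        have e : M ^ 2 * (16 * (|C| + 1)) - |C| * M ^ 2 * 16 = 16 * M ^ 2 := by ring
        nlinarith [sq_nonneg M, e, abs_nonneg C]

/-- `K c ≤ M/4` once `0 ≤ K`, `0 < M`, `c ≤ M/(4(K+1))`. -/
theorem mul_le_quarter {K c M : ℝ} (hK : 0 ≤ K) (hM : 0 < M) (hc : c ≤ M / (4 * (K + 1))) :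
    K * c ≤ M / 4 := by
  calc K * c ≤ K * (M / (4 * (K + 1))) := mul_le_mul_of_nonneg_left hc hK
    _ ≤ M / 4 := by
        rw [mul_div_assoc', div_le_div_iff₀ (by positivity) (by positivity)]
        have e : M * (4 * (K + 1)) - K * M * 4 = 4 * M := by ring
        nlinarith [e, hM.le]

/-- `x ≤ √x` on `[0, 1]`. -/
theorem le_sqrt_self_of_le_one {x : ℝ} (h0 : 0 ≤ x) (h1 : x ≤ 1) : x ≤ √x := by
  have hs1 : √x ≤ 1 := by
    calc √x ≤ √1 := Real.sqrt_le_sqrt h1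
      _ = 1 := Real.sqrt_one
  calc x = √x * √x := (Real.mul_self_sqrt h0).symm
    _ ≤ √x * 1 := mul_le_mul_of_nonneg_left hs1 (Real.sqrt_nonneg _)
    _ = √x := mul_one _

/-! ## The composition (kernel-checked, no `sorry` of its own) -/

set_option maxHeartbeats 800000 in
/-- **The six stubs give `CaptureWith N N 0 N q a₁`** on the diagonal of the exponent up-set, CONDITIONALLY
on the three classical named facts `ChruscielEtAl2001_areaTheorem`, `HawkingEllis1973_achronalBoundary`
(second law) and `Kerr.hasADMEnergy_data` (ADM energy of the Kerr datum): `a₁` and the thresholds `N_E, q`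
from the engine (`k = 0`); `N_A` from ADM pinning; `N := N_E + N_A + 2q + 2` (so `γ = N ≥ 2q + 2`:
inside the basin `χ^{-q} √dist ≤ c′ χ`); basin constant `c := c′²`,
`c′ := min(c_E, 1, 1/(16(|C|+1)), M²/(16(|C|+1)), M/(4(K+1)))`, modulus constant
`K := 3|C| + (8|C| + 6|C|M²)/M`, `p := q`. Then: engine ⇒ limit `(M′, a′)` in the closed family, `J`-budget
and the packages; S2 ⇒ `FarComplete 𝒟`; S3+S4 ⇒ mass budget; S5 ⇒ area budget; `modulus_of_budgets` ⇒
`|M′−M| + |a′−a| ≤ K χ^{-q} √dist`; and `K χ^{-q} √dist ≤ K c′ χ ≤ Mχ/4` ⇒ sub-extremal limit. -/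
theorem captureWith_of_stubs [Kerr.Facts] [Kerr.SliceFacts] :
    ∃ (s : ℕ) (δ : ℝ) (k : ℕ) (γ p a₁ : ℝ), a₁ < 1 ∧ CaptureWith s δ k γ p a₁ := by
  have hAT : ChruscielEtAl2001_areaTheorem.{0} := stub_areaTheoremFact
  have h631 : HawkingEllis1973_achronalBoundary.{0} := HawkingEllis1973_achronalBoundary_holds
  have hKADM := stub_kerrADMEnergyFact
  obtain ⟨a₁, ha₁, NE, q, hE⟩ := stub_closedFamilyCapturePackage
  obtain ⟨NA, hA⟩ := stub_admPinning
  obtain ⟨N, hN⟩ : ∃ N : ℕ, N = NE + NA + 2 * q + 2 := ⟨_, rfl⟩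
  have hNE : NE ≤ N := by omega
  have hNA : NA ≤ N := by omega
  have hNE' : (NE : ℝ) ≤ N := by exact_mod_cast hNE
  have hNA' : (NA : ℝ) ≤ N := by exact_mod_cast hNA
  have hqN : 2 * (q : ℝ) + 2 ≤ N := by
    have : 2 * q + 2 ≤ N := by omega
    exact_mod_cast this
  refine ⟨N, N, 0, N, q, a₁, ha₁, ?_⟩
  intro M hM
  obtain ⟨cE, hcE, C, hE⟩ := hE N N N hNE hNE' hNE' M hM
  -- the modulus constant `K`, the auxiliary constant `c'` and the basin constant `c := c'²`
  obtain ⟨K, hK⟩ : ∃ K : ℝ, K = 3 * |C| + (8 * |C| + 6 * |C| * M ^ 2) * M⁻¹ := ⟨_, rfl⟩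
  have hK0 : 0 ≤ K := by rw [hK]; positivity
  have hp16 : 0 < 1 / (16 * (|C| + 1)) := by positivity
  have hpM : 0 < M ^ 2 / (16 * (|C| + 1)) := by positivity
  have hpK : 0 < M / (4 * (K + 1)) := by positivity
  obtain ⟨c', hc'⟩ : ∃ c' : ℝ, c' = min (min cE 1)
      (min (1 / (16 * (|C| + 1))) (min (M ^ 2 / (16 * (|C| + 1))) (M / (4 * (K + 1))))) :=
    ⟨_, rfl⟩
  have hc'0 : 0 < c' := by
    rw [hc']
    exact lt_min (lt_min hcE one_pos) (lt_min hp16 (lt_min hpM hpK))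
  have hc'E : c' ≤ cE := hc' ▸ (min_le_left _ _).trans (min_le_left _ _)
  have hc'1 : c' ≤ 1 := hc' ▸ (min_le_left _ _).trans (min_le_right _ _)
  have hc'16 : c' ≤ 1 / (16 * (|C| + 1)) := hc' ▸ (min_le_right _ _).trans (min_le_left _ _)
  have hc'M : c' ≤ M ^ 2 / (16 * (|C| + 1)) :=
    hc' ▸ (min_le_right _ _).trans ((min_le_right _ _).trans (min_le_left _ _))
  have hc'K : c' ≤ M / (4 * (K + 1)) :=
    hc' ▸ (min_le_right _ _).trans ((min_le_right _ _).trans (min_le_right _ _))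
  have h16 : |C| * c' ≤ 1 / 16 := abs_mul_le_sixteenth hc'16
  have hE16 : |C| * c' ≤ M ^ 2 / 16 := abs_mul_le_sq_sixteenth hc'M
  have hKc : K * c' ≤ M / 4 := mul_le_quarter hK0 hM hc'K
  have hcc' : c' ^ 2 ≤ c' := by
    rw [sq]; exact (mul_le_mul_of_nonneg_left hc'1 hc'0.le).trans_eq (mul_one c')
  refine ⟨c' ^ 2, pow_pos hc'0 2, K, fun a ha hsub D _ hvac hdist 𝒟 hmax ↦ ?_⟩
  obtain ⟨hx0, hx1⟩ := kappaSq_pos_le_one hsub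
  set x : ℝ := 1 - (a / M) ^ 2 with hx
  -- the engine's basin contains ours
  have hbasin : InitialDataSet.dataWeightedSobolevEDist N (N : ℝ) D (Kerr.data M a M hM.le) <
      ENNReal.ofReal (cE * x ^ (N : ℝ)) :=
    hdist.trans_le (ENNReal.ofReal_le_ofReal
      (mul_le_mul_of_nonneg_right (hcc'.trans hc'E) (Real.rpow_nonneg hx0.le _)))
  -- engine: the limit in the closed family, the angular-momentum budget and the three packages
  obtain ⟨M', a', 𝒟oc, hM'0, ha'le, hconv, hJ, ⟨𝒟', hfar'⟩, ⟨𝓕, h𝓕, hBondi⟩, hHor⟩ :=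
    hE a ha hsub D hvac hbasin 𝒟 hmax
  -- law F′: far-completeness of the MGHD
  have hfar : FarComplete 𝒟 := stub_farCompleteTransport hmax 𝒟' hfar'
  -- law α: ADM pinning + Bondi bookkeeping
  have hADM : (Kerr.afEnd a M).HasADMEnergy D M :=
    hA N N hNA hNA' M hM a hsub (hKADM M a hM hsub) D hvac (hbasin.trans_le le_top)
  have hmass : M' ≤ M + C * x ^ (-(q : ℝ)) *
      √(InitialDataSet.dataWeightedSobolevEDist N (N : ℝ) D (Kerr.data M a M hM.le)).toReal :=
    massBoundBondi hM hADM h𝓕 hBondi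
  -- law β: the ratchet, against the named area theorem
  haveI : 𝒟.metric.HasLeviCivita := 𝒟.metric.toPseudoRiemannianMetric.hasLeviCivita
  obtain ⟨A, hgen, hcollar, hfinal⟩ := hHor
  have harea : M * Kerr.rPlus M a - C * M ^ 2 * x ^ (-(q : ℝ)) *
      √(InitialDataSet.dataWeightedSobolevEDist N (N : ℝ) D (Kerr.data M a M hM.le)).toReal ≤
        M' * Kerr.rPlus M' a' :=
    stub_areaRatchetLaw hAT h631 hM 𝒟 A hgen hcollar hfinal hM'0
  -- the real distance `d`, its root `√d < c' x^{N/2}` and the loss factor `X = x^{-q}`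
  set d : ℝ := (InitialDataSet.dataWeightedSobolevEDist N (N : ℝ) D (Kerr.data M a M hM.le)).toReal
    with hd
  have hd0 : 0 ≤ d := ENNReal.toReal_nonneg
  have hdlt : d < c' ^ 2 * x ^ (N : ℝ) := ENNReal.toReal_lt_of_lt_ofReal hdist
  have hρ0 : 0 ≤ √d := Real.sqrt_nonneg d
  have hρle : √d ≤ c' * x ^ ((N : ℝ) * (1 / 2)) := by
    have h1 : √d ≤ √(c' ^ 2 * x ^ (N : ℝ)) := Real.sqrt_le_sqrt hdlt.le
    have h2 : √(c' ^ 2 * x ^ (N : ℝ)) = c' * x ^ ((N : ℝ) * (1 / 2)) := by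
      rw [Real.sqrt_mul (sq_nonneg c'), Real.sqrt_sq hc'0.le, Real.sqrt_eq_rpow,
        ← Real.rpow_mul hx0.le]
    exact h1.trans_eq h2
  have hX0 : 0 ≤ x ^ (-(q : ℝ)) := Real.rpow_nonneg hx0.le _
  -- inside the basin the loss is absorbed: `x^{-q} √d ≤ c' x`
  have hXρ : x ^ (-(q : ℝ)) * √d ≤ c' * x := by
    have h1 : x ^ (-(q : ℝ)) * √d ≤ x ^ (-(q : ℝ)) * (c' * x ^ ((N : ℝ) * (1 / 2))) :=
      mul_le_mul_of_nonneg_left hρle hX0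
    have h2 : x ^ (-(q : ℝ)) * (c' * x ^ ((N : ℝ) * (1 / 2))) =
        c' * x ^ (-(q : ℝ) + (N : ℝ) * (1 / 2)) := by
      rw [Real.rpow_add hx0]; ring
    have h3 : x ^ (-(q : ℝ) + (N : ℝ) * (1 / 2)) ≤ x := by
      calc x ^ (-(q : ℝ) + (N : ℝ) * (1 / 2)) ≤ x ^ (1 : ℝ) :=
            Real.rpow_le_rpow_of_exponent_ge hx0 hx1 (by linarith only [hqN])
        _ = x := Real.rpow_one x
    calc x ^ (-(q : ℝ)) * √d ≤ c' * x ^ (-(q : ℝ) + (N : ℝ) * (1 / 2)) := by rw [← h2]; exact h1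
      _ ≤ c' * x := mul_le_mul_of_nonneg_left h3 hc'0.le
  -- the three budgets `εα = |C| X √d`, `εβ = |C| M² X √d`, `εγ = |C| X √d`, `X = x^{-q}`
  have hεα0 : 0 ≤ |C| * (x ^ (-(q : ℝ)) * √d) := mul_nonneg (abs_nonneg _) (mul_nonneg hX0 hρ0)
  have hεβ0 : 0 ≤ |C| * M ^ 2 * (x ^ (-(q : ℝ)) * √d) :=
    mul_nonneg (mul_nonneg (abs_nonneg _) (sq_nonneg _)) (mul_nonneg hX0 hρ0)
  have hCle : C * x ^ (-(q : ℝ)) * √d ≤ |C| * (x ^ (-(q : ℝ)) * √d) := by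
    rw [mul_assoc]
    exact mul_le_mul_of_nonneg_right (le_abs_self C) (mul_nonneg hX0 hρ0)
  have hαb : M' ≤ M + |C| * (x ^ (-(q : ℝ)) * √d) := by linarith only [hmass, hCle]
  have hγb : |a' * M' - a * M| ≤ |C| * (x ^ (-(q : ℝ)) * √d) := hJ.trans hCle
  have hβb : M * Kerr.rPlus M a - |C| * M ^ 2 * (x ^ (-(q : ℝ)) * √d) ≤ M' * Kerr.rPlus M' a' := by
    have h1 : C * M ^ 2 * x ^ (-(q : ℝ)) * √d ≤ |C| * M ^ 2 * (x ^ (-(q : ℝ)) * √d) := by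
      have e1 : C * M ^ 2 * x ^ (-(q : ℝ)) * √d = C * M ^ 2 * (x ^ (-(q : ℝ)) * √d) := by ring
      rw [e1]
      exact mul_le_mul_of_nonneg_right (mul_le_mul_of_nonneg_right (le_abs_self C) (sq_nonneg M))
        (mul_nonneg hX0 hρ0)
    linarith only [harea, h1]
  -- smallness of the budgets inside the basin
  have hεβs : |C| * M ^ 2 * (x ^ (-(q : ℝ)) * √d) ≤ M ^ 2 / 16 * √x := by
    have h1 : |C| * M ^ 2 * (x ^ (-(q : ℝ)) * √d) ≤ |C| * M ^ 2 * (c' * x) :=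
      mul_le_mul_of_nonneg_left hXρ (mul_nonneg (abs_nonneg _) (sq_nonneg _))
    have h2 : |C| * M ^ 2 * (c' * x) = (|C| * c') * M ^ 2 * x := by ring
    have h3 : (|C| * c') * M ^ 2 * x ≤ (1 / 16) * M ^ 2 * x :=
      mul_le_mul_of_nonneg_right (mul_le_mul_of_nonneg_right h16 (sq_nonneg M)) hx0.le
    have h4 : (1 / 16) * M ^ 2 * x ≤ (1 / 16) * M ^ 2 * √x :=
      mul_le_mul_of_nonneg_left (le_sqrt_self_of_le_one hx0.le hx1) (by positivity)
    calc |C| * M ^ 2 * (x ^ (-(q : ℝ)) * √d) ≤ (|C| * c') * M ^ 2 * x := by rw [← h2]; exact h1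
      _ ≤ (1 / 16) * M ^ 2 * √x := h3.trans h4
      _ = M ^ 2 / 16 * √x := by ring
  have hεγs : |C| * (x ^ (-(q : ℝ)) * √d) ≤ M ^ 2 / 16 := by
    have h1 : |C| * (x ^ (-(q : ℝ)) * √d) ≤ |C| * (c' * x) :=
      mul_le_mul_of_nonneg_left hXρ (abs_nonneg _)
    have h2 : |C| * (c' * x) ≤ |C| * c' :=
      mul_le_mul_of_nonneg_left (mul_le_of_le_one_right hc'0.le hx1) (abs_nonneg _)
    linarith only [h1, h2, hE16]
  -- the laws pin the parameters (first-law steepness): modulus `K x^{-q} √d`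
  have hmod : |M' - M| + |a' - a| ≤ 3 * (|C| * (x ^ (-(q : ℝ)) * √d)) +
      (8 * (|C| * (x ^ (-(q : ℝ)) * √d)) + 6 * (|C| * M ^ 2 * (x ^ (-(q : ℝ)) * √d))) / M :=
    modulus_of_budgets hM hsub hM'0 ha'le hεα0 hεβ0 hεα0 hαb hβb hγb hεβs hεγs
  have e : 3 * (|C| * (x ^ (-(q : ℝ)) * √d)) +
      (8 * (|C| * (x ^ (-(q : ℝ)) * √d)) + 6 * (|C| * M ^ 2 * (x ^ (-(q : ℝ)) * √d))) / M =
      K * (x ^ (-(q : ℝ)) * √d) := by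
    rw [hK, div_eq_mul_inv]; ring
  have hdrift : |M' - M| + |a' - a| ≤ K * (x ^ (-(q : ℝ)) * √d) := hmod.trans_eq e
  have hmodulus : |M' - M| + |a' - a| ≤ K * x ^ (-(q : ℝ)) * √d := by
    rw [mul_assoc]; exact hdrift
  -- sub-extremality of the limit from the pinned drift `≤ K c' x ≤ M x / 4`
  have hsub' : Kerr.IsSubextremal M' a' := by
    apply isSubextremal_of_drift hM hsub
    have h1 : K * (x ^ (-(q : ℝ)) * √d) ≤ K * (c' * x) := mul_le_mul_of_nonneg_left hXρ hK0
    calc |M' - M| + |a' - a| ≤ K * (c' * x) := hdrift.trans h1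
      _ = (K * c') * x := by ring
      _ ≤ (M / 4) * x := mul_le_mul_of_nonneg_right hKc hx0.le
      _ = M * x / 4 := by ring
  exact ⟨M', a', 𝒟oc, hsub', hfar, hconv, hmodulus⟩

/-- **The crux, BY NAME, from the registered stubs** (read-back `Negative.near_iff`, p73006): open are the
engine S1, ADM pinning S3 and the two fact-stubs (three named Literature facts); S2, S5 are proved (worker files
to land), the law α′ and S6 are kernel-checked. -/
theorem NearExtremalKappaCapture_of :
    Summit.FinalStateConjecture.FinalStateConjecture.Theses.PhaseMixingCapture.NearExtremalKappaCapture :=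
  near_iff.mpr fun {_ _} ↦ captureWith_of_stubs

end Summit.FinalStateConjecture.FinalStateConjecture.Cruxes.NearExtremalKappaCapture.AreaExcessRatchet

end
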